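import Summits.ABC.IUTFork.Thm311Regions
import Summits.ABC.IUTFork.Cor312EdgeYamashita
import HarnessLib

/-!
# [IUTchIII] Corollary 3.12 — readings of the edge, V: the AGGREGATE (procession-normalized, global) form of Reading 4
(c312 crew, V-e)

Record-only file (D-0012) of the abc-iut cell; TAKES NO SIDE. The region-level readings R2/R3/R4 of Step (xi) typed so far
(`ForkRegions` XVII, `Cor312EdgeRegions` V-b, `Cor312EdgeYamashita` V-d) are statements about ONE container; instantiated on
the author's nouns (c312-1 `Thm311.PilotNouns`, one `Cor312Setting` per component `(j, v_ℚ)` via `toCor312Setting`) they become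
COMPONENTWISE hypotheses — "in every packet the `q`-pilot region lies in / is congruent to a sub-region of the hull". The print,
however, compares two GLOBAL numbers: [IUTchIII] Cor. 3.12 p. 174 "the procession-normalized mono-analytic log-volume [i.e., where
the average is taken over `j ∈ 𝔽_l^⋇`] of the holomorphic hull of the union of the possible images" versus "… of the image of a
`q`-pilot object"; Step (xi-d) p. 183 "`ℝ_{≤−|log(Θ)|} ⊆ ℝ`; `−|log(q)| ∈ ℝ`". The skeleton seat's FORK FINDING (2026-08-25T23:23Z,
XXIV `ForkLocalGlobal`) records why the distinction bites: per packet, at a deep bad place and label `j ≥ 2`, the Θ-side volume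
(`∝ −j²·ord_v(q_v)`) lies BELOW the `q`-side (`∝ −ord_v(q_v)`), so every componentwise reading is argued false in intended models,
while the aggregate inequality sets the deficit against the inflation terms of all places.

This file types Yamashita's sentence (Cor. 13.13 proof p. 360: the hull "contains a region which is isomorphic (not equal) to the
region determined by the q-pilot objects", log-volumes invariant) with the print's GLOBAL quantifier, in c312-1's currency:

* `PilotNouns.QCongruentSubHullAgg P n m` — there is an admissible family of regions `R_{j,v_ℚ} ⊆ U^{hol}_{j,v_ℚ}` with finitely many
  non-zero log-volumes whose PROCESSION-NORMALIZED AGGREGATE log-volume equals `−|log(q)|` (no packet-by-packet equality).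
* `cor312At_of_qCongruentSubHullAgg` — it suffices for the author's aggregate `Cor312At` (monotonicity packet by packet, then the sum):
  the weakest sufficient region-level reading typed in the cell so far.
* `qCongruentSubHullAgg_of_componentwise` — the componentwise Reading 4 (hence, by V-d `four_readings`, componentwise R1/R2/R3) implies it.
* CONVERSELY NOTHING, and more: `aggCongruent_tolerates_componentwise_failure` — for an abstract two-component family
  (`Cor312Proof.AggCongruent`/`AggCor312` for any finite family `C : ι → Cor312Setting`) the aggregate reading holds while in one component even the
  INEQUALITY fails (`q`-side volume above the hull's): the aggregate form is compatible with the deep-bad-place phenomenon that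
  refutes the componentwise forms. (`aggCor312_of_aggCongruent`, `aggCongruent_of_componentwise` are the abstract twins.)

* HOW LITTLE IS LEFT at the aggregate level: conversely, the aggregate inequality gives the aggregate reading back as soon as the hulls
  admit admissible sub-families of every intermediate aggregate log-volume (an intermediate-value property that honest containers with
  an archimedean component have; it fails in the discrete witness containers of V-b/V-d, which is the only reason `edge_not_imp_yamashita`
  separates them). So with the print's global quantifier Reading 4 carries essentially NO content beyond the inequality itself — the
  kernel form of the skeleton seat's conclusion "over the frozen Setting the weakest global volume statement is the Statement itself":
  whatever licenses Step (xi-f) must be a statement about the multiradial algorithm and its input strip (skel XXV `ForkInputStrip`), not a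
  region-containment inside the frozen setting.

Everything here is bookkeeping over LANDED decls (c312-1 `PilotNouns`, `ComponentAdm`, `toCor312Setting`, `Cor312At`; skel XVII;
V-d) plus one finite witness; which reading, if any, [IUTchIII] supplies is not recorded as anyone's.
[cite: Yamashita2024IUTSurvey, Cor. 13.13 proof p. 360 ll. 30–40] [claim: Mochizuki2012, status: disputed]
-/

noncomputable section

namespace Summit.ABC.IUTFork

open Set

/-! ## 1. The aggregate reading in the author's nouns -/

namespace Thm311.PilotNouns

variable {T : ThetaIndex} {S : LatticeSituation T} (P : PilotNouns S)

/-- READING 4, AGGREGATE FORM (Yamashita2024IUTSurvey Cor. 13.13 proof p. 360 ll. 35–40 "the holomorphic hull of the union of possible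
images of Θ-pilot objects … contains a region which is isomorphic (not equal) to the region determined by the q-pilot objects",
read with the print's global quantifier, [IUTchIII] Cor. 3.12 p. 174 "procession-normalized … log-volume"): an admissible family of
sub-regions of the hulls, finitely many with non-zero log-volume, whose procession-normalized aggregate log-volume is `−|log(q)|`.
HYPOTHESIS. [cite: Yamashita2024IUTSurvey, Cor. 13.13 proof p. 360 ll. 30–40] [claim: Mochizuki2012, status: disputed] -/
@[claim "Mochizuki2012" "disputed"]
def QCongruentSubHullAgg (n m : ℤ) : Prop :=
  ∃ R : ∀ (j : T.LabelStar) (vQ : T.VQ), Set (S.L.Packet j.1 vQ),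
    (∀ (j : T.LabelStar) (vQ : T.VQ), (S.D n).Adm j.1 vQ (R j vQ)) ∧
    (∀ (j : T.LabelStar) (vQ : T.VQ), R j vQ ⊆ P.Uhol n m j vQ) ∧
    {p : T.LabelStar × T.VQ | (S.D n).logvol p.1.1 p.2 (R p.1 p.2) ≠ 0}.Finite ∧
    (1 / (T.lstar : ℝ)) * ∑ᶠ (j : T.LabelStar) (vQ : T.VQ), (S.D n).logvol j.1 vQ (R j vQ) = P.negLogQ n m

/-- The component setting's `U^{hol}` is the author's `Uhol` at that component. [folklore] -/
theorem toCor312Setting_Uhol (n m : ℤ) (j : T.LabelStar) (vQ : T.VQ) (h : P.ComponentAdm n m j vQ) :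
    (P.toCor312Setting n m j vQ h).Uhol = P.Uhol n m j vQ := by
  show P.hull n j.1 vQ (⋃ R : P.possibleImages n m j vQ, R.1) = _
  rw [← Set.sUnion_eq_iUnion]
  rfl

/-- **The aggregate reading suffices for the author's aggregate `Cor312At`**: packet by packet `μ^log(R_{j,v_ℚ}) ≤ μ^log(U^{hol}_{j,v_ℚ})`
by monotonicity, then sum and normalize — `−|log(q)| = (1/l⋇)·Σ μ^log(R) ≤ (1/l⋇)·Σ μ^log(U^{hol}) = −|log(Θ)|`. [folklore] -/
theorem cor312At_of_qCongruentSubHullAgg (n m : ℤ) (h : ∀ (j : T.LabelStar) (vQ : T.VQ), P.ComponentAdm n m j vQ)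
    (hreal : P.NegLogThetaReal n m) (hqreal : P.NegLogQReal n m) (hagg : P.QCongruentSubHullAgg n m) :
    P.Cor312At n m := by
  obtain ⟨R, hadmR, hsub, hfin, hsum⟩ := hagg
  refine ⟨hreal, hqreal, ?_⟩
  rw [← hsum]
  unfold negLogTheta
  have hl : (0 : ℝ) ≤ 1 / (T.lstar : ℝ) := by positivity
  refine mul_le_mul_of_nonneg_left ?_ hl
  have hθ : ∀ j : T.LabelStar,
      Function.HasFiniteSupport fun vQ => (S.D n).logvol j.1 vQ (P.Uhol n m j vQ) := by
    intro j
    refine (hreal.2.image Prod.snd).subset ?_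
    intro vQ hvQ
    exact ⟨(j, vQ), hvQ, rfl⟩
  have hR : ∀ j : T.LabelStar, Function.HasFiniteSupport fun vQ => (S.D n).logvol j.1 vQ (R j vQ) := by
    intro j
    refine (hfin.image Prod.snd).subset ?_
    intro vQ hvQ
    exact ⟨(j, vQ), hvQ, rfl⟩
  refine finsum_le_finsum' (Set.toFinite _) (Set.toFinite _) fun j => ?_
  exact finsum_le_finsum' (hR j) (hθ j) fun vQ => (h j vQ).mono (hadmR j vQ) (h j vQ).Uhol_adm (hsub j vQ)

/-- **Componentwise Reading 4 ⟹ the aggregate reading** (choose the congruent sub-region in every component; its log-volumes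
ARE the `q`-pilot log-volumes packet by packet, so the finiteness guard is `NegLogQReal`'s). Hence (V-d `four_readings`) every
componentwise reading R1/R2/R3/R4 implies the aggregate one. [folklore] -/
theorem qCongruentSubHullAgg_of_componentwise (n m : ℤ) (h : ∀ (j : T.LabelStar) (vQ : T.VQ), P.ComponentAdm n m j vQ)
    (hqreal : P.NegLogQReal n m)
    (hc : ∀ (j : T.LabelStar) (vQ : T.VQ), (P.toCor312Setting n m j vQ (h j vQ)).QCongruentSubHull) :
    P.QCongruentSubHullAgg n m := by
  choose R hR using hc
  have hvol : ∀ (j : T.LabelStar) (vQ : T.VQ),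
      (S.D n).logvol j.1 vQ (R j vQ) = (S.D n).logvol j.1 vQ (P.qRegion n m j vQ) := fun j vQ => (hR j vQ).2.2
  refine ⟨R, fun j vQ => (hR j vQ).1, fun j vQ => ?_, ?_, ?_⟩
  · rw [← P.toCor312Setting_Uhol n m j vQ (h j vQ)]
    exact (hR j vQ).2.1
  · refine hqreal.2.subset ?_
    rintro ⟨j, vQ⟩ hp
    simpa only [Set.mem_setOf_eq, hvol] using hp
  · unfold negLogQ
    congr 1
    exact finsum_congr fun j => finsum_congr fun vQ => hvol j vQ

/-- Componentwise Reading 2 (`QSubHull`, the licence of `DAGC312g.summit_of_cor312_M_licence`) ⟹ the aggregate reading. [folklore] -/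
theorem qCongruentSubHullAgg_of_componentwise_qSubHull (n m : ℤ)
    (h : ∀ (j : T.LabelStar) (vQ : T.VQ), P.ComponentAdm n m j vQ) (hqreal : P.NegLogQReal n m)
    (hc : ∀ (j : T.LabelStar) (vQ : T.VQ), (P.toCor312Setting n m j vQ (h j vQ)).QSubHull) :
    P.QCongruentSubHullAgg n m :=
  P.qCongruentSubHullAgg_of_componentwise n m h hqreal fun j vQ => Cor312Setting.qCongruentSubHull_of_qSubHull _ (hc j vQ)

end Thm311.PilotNouns

/-! ## 2. The same bookkeeping over an abstract finite family, and the witness -/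

namespace Cor312Proof

/-! Abstract twin of `PilotNouns`' components `(j, v_ℚ)`: a finite family `C : ι → Cor312Setting` of component settings, aggregated by
plain sums (no structure, no instance: the index type carries its own `Fintype`). -/

section AggFamily

variable {ι : Type} [Fintype ι] (C : ι → Cor312Setting)

/-- aggregate `−|log(Θ)|` of a finite family := `Σ_i ln ν̄(U^{hol}_i)`. [folklore] -/
def aggNegLogTheta : ℝ := ∑ i, (C i).negLogTheta

/-- aggregate `−|log(q)|` := `Σ_i ln ν̄(Q_i)`. [folklore] -/
def aggNegAbsLogq : ℝ := ∑ i, (C i).negAbsLogq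

/-- the aggregate inequality `Σ ln ν̄(Q_i) ≤ Σ ln ν̄(U^{hol}_i)` for a finite family of component settings. HYPOTHESIS.
[claim: Mochizuki2012, status: disputed] -/
@[claim "Mochizuki2012" "disputed"] def AggCor312 : Prop := aggNegAbsLogq C ≤ aggNegLogTheta C

/-- READING 4, AGGREGATE FORM, abstractly: admissible `R_i ⊆ U^{hol}_i` with `Σ ln ν̄(R_i) = Σ ln ν̄(Q_i)`. HYPOTHESIS.
[cite: Yamashita2024IUTSurvey, Cor. 13.13 proof p. 360 ll. 30–40] [claim: Mochizuki2012, status: disputed] -/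
@[claim "Mochizuki2012" "disputed"]
def AggCongruent : Prop :=
  ∃ R : ∀ i, Set (C i).L, (∀ i, (C i).Adm (R i) ∧ R i ⊆ (C i).Uhol) ∧ ∑ i, (C i).logvol (R i) = aggNegAbsLogq C

/-- Aggregate Reading 4 ⟹ the aggregate inequality (monotonicity componentwise, then `Finset.sum_le_sum`). [folklore] -/
theorem aggCor312_of_aggCongruent (h : AggCongruent C) : AggCor312 C := by
  obtain ⟨R, hR, hsum⟩ := h
  unfold AggCor312
  rw [← hsum]
  exact Finset.sum_le_sum fun i _ => (C i).logvol_mono (hR i).1 (C i).adm_Uhol (hR i).2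

/-- Componentwise Reading 4 ⟹ aggregate Reading 4. [folklore] -/
theorem aggCongruent_of_componentwise (h : ∀ i, (C i).QCongruentSubHull) : AggCongruent C := by
  choose R hR using h
  exact ⟨R, fun i => ⟨(hR i).1, (hR i).2.1⟩, Finset.sum_congr rfl fun i _ => (hR i).2.2⟩

/-- Componentwise `Cor312` ⟹ the aggregate inequality. [folklore] -/
theorem aggCor312_of_componentwise (h : ∀ i, (C i).Cor312) : AggCor312 C :=
  Finset.sum_le_sum fun i _ => h i

end AggFamily

/-- Witness component 0 (roomy): container `yamWitnessContainer` (V-d: `ln ν̄(A) = 𝟙_A(0)+𝟙_A(1)+𝟙_A(5)−3`, hull = id), one possible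
image `{0,1}` (`ln ν̄ = −1`), `q`-pilot image `{7}` (`ln ν̄ = −3`). [folklore] -/
def aggWitness₀ : Cor312Setting where
  toVolumeContainer := yamWitnessContainer
  Idx := Unit
  U _ := ({0, 1} : Set ℕ)
  U_adm _ := trivial
  Uhol_adm := trivial
  Q := ({7} : Set ℕ)
  Q_adm := trivial

/-- Witness component 1 (deep bad place): same container, one possible image `{0}` (`ln ν̄ = −2`), `q`-pilot image `{0,1}`
(`ln ν̄ = −1`) — here the `q`-side volume EXCEEDS the hull's. [folklore] -/
def aggWitness₁ : Cor312Setting where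
  toVolumeContainer := yamWitnessContainer
  Idx := Unit
  U _ := ({0} : Set ℕ)
  U_adm _ := trivial
  Uhol_adm := trivial
  Q := ({0, 1} : Set ℕ)
  Q_adm := trivial

/-- The two-component witness family (`false ↦` component 0, `true ↦` component 1). [folklore] -/
def aggWitness (b : Bool) : Cor312Setting := cond b aggWitness₁ aggWitness₀

/-- `ln ν̄({0,1}) = −1` in the witness container. [folklore] -/
private theorem vol_01 : yamWitnessContainer.logvol ({0, 1} : Set ℕ) = -1 := by
  simp only [yamWitnessContainer, Set.indicator_apply, Set.mem_insert_iff, Set.mem_singleton_iff]; norm_num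

/-- `ln ν̄({0}) = −2` in the witness container. [folklore] -/
private theorem vol_0 : yamWitnessContainer.logvol ({0} : Set ℕ) = -2 := by
  simp only [yamWitnessContainer, Set.indicator_apply, Set.mem_singleton_iff]; norm_num

/-- `ln ν̄({7}) = −3` in the witness container. [folklore] -/
private theorem vol_7 : yamWitnessContainer.logvol ({7} : Set ℕ) = -3 := by
  simp only [yamWitnessContainer, Set.indicator_apply, Set.mem_singleton_iff]; norm_num

/-- the hull of component 0 is `{0,1}`. [folklore] -/
private theorem uhol₀ : aggWitness₀.Uhol = ({0, 1} : Set ℕ) := by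
  show ClosureOperator.id (Set ℕ) (⋃ _ : Unit, ({0, 1} : Set ℕ)) = {0, 1}
  rw [Set.iUnion_const]; rfl

/-- the hull of component 1 is `{0}`. [folklore] -/
private theorem uhol₁ : aggWitness₁.Uhol = ({0} : Set ℕ) := by
  show ClosureOperator.id (Set ℕ) (⋃ _ : Unit, ({0} : Set ℕ)) = {0}
  rw [Set.iUnion_const]; rfl

/-- **The aggregate reading tolerates componentwise failure.** In the two-component witness the aggregate Reading 4 holds
(`R₀ = {0} ⊆ {0,1}`, `R₁ = {0} = U^{hol}_1`: `Σ ln ν̄(R) = −2 + (−2) = −4 = −3 + (−1) = Σ ln ν̄(Q)`), hence the aggregate inequality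
(`−4 ≤ −3`), while in component 1 even the INEQUALITY fails (`ln ν̄(Q₁) = −1 > −2 = ln ν̄(U^{hol}_1)`) — so no componentwise reading
(R1–R4, nor `Cor312` itself) holds there. Abstract shape of the deep-bad-place phenomenon (skel XXIV): global comparison can survive
local deficits. [folklore] -/
theorem aggCongruent_tolerates_componentwise_failure :
    ∃ (ι : Type) (_ : Fintype ι) (C : ι → Cor312Setting),
      AggCongruent C ∧ AggCor312 C ∧ ∃ i, ¬ (C i).Cor312 ∧ ¬ (C i).QCongruentSubHull := by
  have hq₀ : aggWitness₀.negAbsLogq = -3 := vol_7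
  have hq₁ : aggWitness₁.negAbsLogq = -1 := vol_01
  have hΘ₁ : aggWitness₁.negLogTheta = -2 := by
    show yamWitnessContainer.logvol aggWitness₁.Uhol = -2
    rw [uhol₁, vol_0]
  have hagg : AggCongruent aggWitness := by
    refine ⟨fun b => @Bool.rec (fun b => Set (aggWitness b).L) ({0} : Set ℕ) ({0} : Set ℕ) b, fun b => ?_, ?_⟩
    · cases b
      · refine ⟨trivial, ?_⟩
        show ({0} : Set ℕ) ⊆ aggWitness₀.Uhol
        rw [uhol₀]; simp
      · refine ⟨trivial, ?_⟩
        show ({0} : Set ℕ) ⊆ aggWitness₁.Uhol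
        rw [uhol₁]
    · show ∑ b : Bool, (aggWitness b).logvol (@Bool.rec (fun b => Set (aggWitness b).L) ({0} : Set ℕ) ({0} : Set ℕ) b) =
        ∑ b : Bool, (aggWitness b).negAbsLogq
      rw [Fintype.sum_bool, Fintype.sum_bool]
      show yamWitnessContainer.logvol ({0} : Set ℕ) + yamWitnessContainer.logvol ({0} : Set ℕ) =
        aggWitness₁.negAbsLogq + aggWitness₀.negAbsLogq
      rw [vol_0, hq₀, hq₁]; norm_num
  have hnot : ¬ aggWitness₁.Cor312 := by
    unfold Cor312Setting.Cor312
    rw [hq₁, hΘ₁]; norm_num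
  refine ⟨Bool, inferInstance, aggWitness, hagg, aggCor312_of_aggCongruent _ hagg, true, hnot, fun h => hnot ?_⟩
  exact aggWitness₁.cor312_of_qCongruentSubHull h

end Cor312Proof

end Summit.ABC.IUTFork

end
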